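import Summits.Ventures.Crystal3D.Theorems.StickyWulffConstantGenericWallFloorConeCertificateRho
import Summits.Ventures.Crystal3D.Theorems.StickyWulffConstantGenericWallFloorConeCertDataP5

/-!
# Cone certificates — aggregate tube radii `ρ` for the landed data (P5)

Helper for `stmt-Ventures-19480` (E1, inside-tube half).  For each landed certificate `cert_<frame>_<rep>`
(files imported above) one theorem `cert_<frame>_<rep>_rho : cert_<frame>_<rep>.rhoCheck p 1000 = true := by decide`
and one `cert_<frame>_<rep>_slotInj` (slots pairwise distinct, by decide),
so that `ConeCert.eq_slots_rho` / `eq_slots_rho_dist` (file `…ConeCertificateRho`) apply with the per-ball chord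
radius `ρ = p/1000` (listed per orbit in the docstrings; lit g11 HOME/cf-lit/lean/conecert/TABLE.md).  `p` is
`⌊1000·ρ_LP⌋` for the multipliers of the landed certificate (kit j292345/j292347 reproduce them exactly); the kernel
checks the inequality, the generator is not trusted.

lit g11 (crystal3d-full).
[Part 1/1 of lit's `…ConeCertRhoP5.lean` (2 of 2 certificates), landed for lit g11 (perm-blocked under
`Theorems/`) by prover 19480-p2; imports the ρ core and the tree's split data files …DataP5.]
-/

namespace Summit.Ventures.Crystal3D.Theorems

/-- `cert_A12_451` (|O| = 5): aggregate tube radius ρ = 96/1000 (LP value 0.0963; κ₀ = 92/1000, old radius κ₀/3 = 0.031). -/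
theorem cert_A12_451_rho : cert_A12_451.rhoCheck 96 1000 = true := by decide

/-- The slots of `cert_A12_451` are pairwise distinct (hypothesis `hinj` of `ConeCert.eq_slotSet_of_etaMatched`). -/
theorem cert_A12_451_slotInj : ∀ i j, cert_A12_451.slot i = cert_A12_451.slot j → i = j := by decide

/-- `cert_C12_55` (|O| = 5): aggregate tube radius ρ = 74/1000 (LP value 0.0744; κ₀ = 88/1000, old radius κ₀/3 = 0.029). -/
theorem cert_C12_55_rho : cert_C12_55.rhoCheck 74 1000 = true := by decide

/-- The slots of `cert_C12_55` are pairwise distinct (hypothesis `hinj` of `ConeCert.eq_slotSet_of_etaMatched`). -/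
theorem cert_C12_55_slotInj : ∀ i j, cert_C12_55.slot i = cert_C12_55.slot j → i = j := by decide

end Summit.Ventures.Crystal3D.Theorems
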